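import Summits.QuantumFields.BalabanUV.Beta.D1BFx.SliceTransferDefect
import Summits.QuantumFields.BalabanUV.Beta.D1BFx.GramWeightJetsMixed

/-!
# `BalabanUV.Beta.D1BFx.SliceTransferDefectJets` — road «BF-x» for binder row D1, slot (K), row **(K8-L) «NON-LOCAL REDUCTION»**, PART 2a
# (jet algebra): THE 2-JETS OF THE DEFLATED FORM `u ↦ Y − Y·W·(WᵀYW)⁻¹·Wᵀ·Y` AND THE PROOF THAT ITS WARD LETTERS ARE IDENTITIES

HONEST DEPENDENCY (cell records, verbatim): «continuum YM on T⁴ ⇐ BetaPertH ∧ nine spine estimates (0/9 proved); BetaPertH ⇐ (D1) ∧ (D4) ∧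
CAP+tail; G-an2-4 gates asym, D1 and NE2/3/4.»  HONEST FRAMING (cell contract, verbatim): «discharging `BetaPertH` makes Bałaban's UV stability
UNCONDITIONAL — a real constructive-QFT result; it is NOT the continuum limit and NOT the Clay problem.»  THIS MODULE DISCHARGES NOTHING of (K),
of D1 or of the wall: [our object] names for the formal jets (definitions asserting nothing) + [folklore] finite-dimensional matrix algebra over
the road owner's PART 1 `D1BFx.SliceTransferDefect` (p248562) and gan24-leaf-03's K-TA4G `D1BFx.GramWeightJets(Mixed)` BY NAME.  No `def … : Prop`,
nothing cited, no wall binder instantiated, 0 sorry.  The structural letter «WARD-L» of F-g8-2 §2 is NOT touched.  NOT D1, NOT BetaPertH, NOT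
continuum, NOT Clay.

ABSOLUTE RULE (cell charter, verbatim): «No internally-minted statement may enter as a cited fact. Every hypothesis is either kernel-proved in this
package or a verbatim quotation of a PUBLISHED theorem with page reference. The manuscript(s) under audit are NOT citable for their own disputed
steps — they are the thing under adjudication; programme-internal (2001/route/tribunal) claims are never citable.»

WHY (owner FINDING F-g8-2 ∕ RULING ρ-g8-3, `HOME/b2b-balaban-beta-d1-p2/SLICE-TRANSFER-DEFECT.md` §0 item 2, and the owner's cut «(ii)» for this
seat, journal 2026-08-21T04:38Z).  PART 1 proved, at the determinant level and with NO Ward letter and NO rank hypothesis, that the weighted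
`Q`-bordered system of a symmetric form `Y` computes the SHARP (comb-sliced) determinant of the DEFLATED form `Y − YWΦ⁻¹WᵀY` (`Φ := WᵀYW`), i.e. of
`K + defect K B W` when `Y = K + B`.  K-TA4G (`GramWeightJetsMixed.hessT_gramTransfer_jets`) turns such a determinant identity into the identity
of one-loop functionals `hessT` along 2-parameter jets — PROVIDED the form's jets obey the order ≤ 2 Ward letters `K•W• = 0` (there:
hypotheses a•).  For the deflated form these letters are IDENTITIES: `(Y − YWΦ⁻¹WᵀY)(u)·W(u) ≡ 0` for every curve, so every jet of the
product vanishes.  This file NAMES the jets of the deflated form as explicit matrix polynomials (product rule + inverse-jet rule, in K-TA4G's own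
co-frame currency `T := WᵀY`, `A := Φ⁻¹`, so that `deflated + TᵀAT = Y` jet by jet by `sub_add_cancel`) and PROVES the letters as identities
by expansion (contracting `Φ₀⁻¹·(W₀ᵀY₀W₀) = 1`; a free-algebra normaliser in the seat's scratch reproduces the cancellations: 10 resp. 86 raw
monomials → 0).  PART 2b (`SliceTransferDefectHess`) feeds them to K-TA4G.
CONTENT (real matrices; `ι` fluctuation index, `κ` gauge-mode index; all jets FORMAL — symbols, no curves):
* §1 [our object] `coT₁`, `coTMix` (jets of the canonical co-frame `WᵀY`), `invJet₁`, `invJetMix` (jets of an inverse `G⁻¹`), `deflJet₀`,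
  `deflJet₁`, `deflJetMix` (0-, first and mixed second jet of the deflated form; the pure second jet is the diagonal `t := s` of the mixed one).
* §2 [folklore] small algebra: `gram₀_self` (`(WᵀY)·W = Φ₀`-type bookkeeping: `coT•·W•`-jets ARE the Gram jets `gram₁ W₀ Wₛ Y₀ Yₛ`,
  `gramMix W… Y…` — `coT₁_mul`, `coTMix_mul`), `deflJet₀_eq_deflate` (`deflJet₀ Y₀ W₀ =` PART 1's `Y₀ − Y₀W₀Φ₀⁻¹W₀ᵀY₀`), `deflJet₀_add_eq`
  (`deflJet₀ (K+B) W = K + defect K B W`), symmetry: `gram₁_transpose_of_symm`, `gramMix_transpose_of_symm`, `invJet₁_transpose_of_symm`,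
  `invJetMix_transpose_of_symm`, `deflJet₀∕₁∕Mix_transpose` (the deflated jets of symmetric data are symmetric).
* §3 [folklore] **THE WARD LETTERS OF THE DEFLATED JETS ARE IDENTITIES** (hypotheses: `Y•ᵀ = Y•`, `det Φ₀ ≠ 0` ONLY):
  `deflJet₀_mul_basis` (`K̃₀W₀ = 0`, = PART 1's `deflate_mul_basis`), **`deflJet₁_mul_basis`** (`K̃ₛW₀ + K̃₀Wₛ = 0`),
  **`deflJetMix_mul_basis`** (`K̃ₛₜW₀ + K̃ₛWₜ + K̃ₜWₛ + K̃₀Wₛₜ = 0`), the diagonal `deflJetMix_mul_basis_diag` (`K̃ₛₛW₀ + 2•K̃ₛWₛ + K̃₀Wₛₛ = 0`)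
  and the six transposed letters (`…_transpose_mul_basis`).
Provenance: D1 formalisation swarm leaf seat `b2b-balaban-beta-d1-formalise-leaf-04` gen 8 (claim «D1-BFx-K8L» PART 2, cut (ii) by the road
owner `b2b-balaban-beta-d1-p2` gen 8), 2026-08-21.
-/

noncomputable section

namespace Summit.QuantumFields.BalabanUV.Beta.D1BFx.SliceTransferDefectJets

open Matrix
open Summit.QuantumFields.BalabanUV.Beta.D1BFx.GramWeightJets (gram₀ gram₁)
open Summit.QuantumFields.BalabanUV.Beta.D1BFx.GramWeightJetsMixed (gramMix)
open Summit.QuantumFields.BalabanUV.Beta.D1BFx.SliceTransferDefect (defect defect_def deflate_mul_basis)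

variable {ι κ : Type*} [Fintype ι] [Fintype κ] [DecidableEq κ]

/-! ## §1 The formal jets (definitions; they assert nothing) -/

/-- [our object] FIRST JET OF THE CANONICAL CO-FRAME `u ↦ W(u)ᵀ·Y(u)` (product rule): `W₁ᵀY₀ + W₀ᵀY₁`. -/
def coT₁ (W₀ W₁ : Matrix ι κ ℝ) (Y₀ Y₁ : Matrix ι ι ℝ) : Matrix κ ι ℝ :=
  W₁ᵀ * Y₀ + W₀ᵀ * Y₁

/-- [our object] MIXED SECOND JET OF THE CANONICAL CO-FRAME `WᵀY` (product rule along `s` and `t`). -/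
def coTMix (W₀ Wₛ Wₜ Wₛₜ : Matrix ι κ ℝ) (Y₀ Yₛ Yₜ Yₛₜ : Matrix ι ι ℝ) : Matrix κ ι ℝ :=
  Wₛₜᵀ * Y₀ + Wₛᵀ * Yₜ + Wₜᵀ * Yₛ + W₀ᵀ * Yₛₜ

omit [Fintype ι] in
/-- [our object] FIRST JET OF AN INVERSE: `(G⁻¹)₁ = −G₀⁻¹G₁G₀⁻¹`. -/
def invJet₁ (G₀ G₁ : Matrix κ κ ℝ) : Matrix κ κ ℝ :=
  -(G₀⁻¹ * G₁ * G₀⁻¹)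

omit [Fintype ι] in
/-- [our object] MIXED SECOND JET OF AN INVERSE: `(G⁻¹)ₛₜ = G₀⁻¹GₛG₀⁻¹GₜG₀⁻¹ + G₀⁻¹GₜG₀⁻¹GₛG₀⁻¹ − G₀⁻¹GₛₜG₀⁻¹`. -/
def invJetMix (G₀ Gₛ Gₜ Gₛₜ : Matrix κ κ ℝ) : Matrix κ κ ℝ :=
  G₀⁻¹ * Gₛ * G₀⁻¹ * Gₜ * G₀⁻¹ + G₀⁻¹ * Gₜ * G₀⁻¹ * Gₛ * G₀⁻¹ - G₀⁻¹ * Gₛₜ * G₀⁻¹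

/-- [our object] ZEROTH JET OF THE DEFLATED FORM in K-TA4G's co-frame currency: `Y₀ − gram₀ (W₀ᵀY₀) Φ₀⁻¹ = Y₀ − (W₀ᵀY₀)ᵀ·Φ₀⁻¹·(W₀ᵀY₀)`,
`Φ₀ = gram₀ W₀ Y₀ = W₀ᵀY₀W₀`. -/
def deflJet₀ (Y₀ : Matrix ι ι ℝ) (W₀ : Matrix ι κ ℝ) : Matrix ι ι ℝ :=
  Y₀ - gram₀ (W₀ᵀ * Y₀) (gram₀ W₀ Y₀)⁻¹

/-- [our object] FIRST JET OF THE DEFLATED FORM: `Y₁ − gram₁ (T₀, T₁; A₀, A₁)` with `T• =` co-frame jets, `A• =` inverse jets of `Φ• = gram• W Y`. -/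
def deflJet₁ (Y₀ Y₁ : Matrix ι ι ℝ) (W₀ W₁ : Matrix ι κ ℝ) : Matrix ι ι ℝ :=
  Y₁ - gram₁ (W₀ᵀ * Y₀) (coT₁ W₀ W₁ Y₀ Y₁) (gram₀ W₀ Y₀)⁻¹ (invJet₁ (gram₀ W₀ Y₀) (gram₁ W₀ W₁ Y₀ Y₁))

/-- [our object] MIXED SECOND JET OF THE DEFLATED FORM: `Yₛₜ − gramMix (T•; A•)` (nine-term product rule of `TᵀAT`). -/
def deflJetMix (Y₀ Yₛ Yₜ Yₛₜ : Matrix ι ι ℝ) (W₀ Wₛ Wₜ Wₛₜ : Matrix ι κ ℝ) : Matrix ι ι ℝ :=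
  Yₛₜ - gramMix (W₀ᵀ * Y₀) (coT₁ W₀ Wₛ Y₀ Yₛ) (coT₁ W₀ Wₜ Y₀ Yₜ) (coTMix W₀ Wₛ Wₜ Wₛₜ Y₀ Yₛ Yₜ Yₛₜ)
    (gram₀ W₀ Y₀)⁻¹ (invJet₁ (gram₀ W₀ Y₀) (gram₁ W₀ Wₛ Y₀ Yₛ)) (invJet₁ (gram₀ W₀ Y₀) (gram₁ W₀ Wₜ Y₀ Yₜ))
    (invJetMix (gram₀ W₀ Y₀) (gram₁ W₀ Wₛ Y₀ Yₛ) (gram₁ W₀ Wₜ Y₀ Yₜ) (gramMix W₀ Wₛ Wₜ Wₛₜ Y₀ Yₛ Yₜ Yₛₜ))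

/-! ## §2 Small algebra: co-frame products, the link to PART 1, symmetry -/

section Algebra

variable (Y₀ Yₛ Yₜ Yₛₜ : Matrix ι ι ℝ) (W₀ Wₛ Wₜ Wₛₜ : Matrix ι κ ℝ)

omit [Fintype κ] [DecidableEq κ] in
/-- [folklore] `(W₀ᵀY₀)·W₀ = gram₀ W₀ Y₀` (by `rfl`). -/
theorem coT₀_mul : W₀ᵀ * Y₀ * W₀ = gram₀ W₀ Y₀ := rfl

omit [Fintype κ] [DecidableEq κ] in
/-- [folklore] The first jet of `(WᵀY)·W` IS the first FP-Gram jet: `T₁W₀ + T₀W₁ = gram₁ W₀ W₁ Y₀ Y₁` (by `rfl`). -/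
theorem coT₁_mul : coT₁ W₀ Wₛ Y₀ Yₛ * W₀ + W₀ᵀ * Y₀ * Wₛ = gram₁ W₀ Wₛ Y₀ Yₛ := rfl

omit [Fintype κ] [DecidableEq κ] in
/-- [folklore] The mixed jet of `(WᵀY)·W` IS the mixed FP-Gram jet `gramMix W… Y…`. -/
theorem coTMix_mul :
    coTMix W₀ Wₛ Wₜ Wₛₜ Y₀ Yₛ Yₜ Yₛₜ * W₀ + coT₁ W₀ Wₛ Y₀ Yₛ * Wₜ + coT₁ W₀ Wₜ Y₀ Yₜ * Wₛ + W₀ᵀ * Y₀ * Wₛₜ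
      = gramMix W₀ Wₛ Wₜ Wₛₜ Y₀ Yₛ Yₜ Yₛₜ := by
  simp only [coTMix, coT₁, gramMix, Matrix.add_mul]
  abel

/-- [folklore] LINK TO PART 1: `deflJet₀ Y₀ W₀ = Y₀ − Y₀·W₀·Φ₀⁻¹·W₀ᵀ·Y₀` for symmetric `Y₀` (the road owner's deflated form). -/
theorem deflJet₀_eq_deflate (hY₀ : Y₀ᵀ = Y₀) :
    deflJet₀ Y₀ W₀ = Y₀ - Y₀ * W₀ * (W₀ᵀ * Y₀ * W₀)⁻¹ * W₀ᵀ * Y₀ := by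
  simp only [deflJet₀, gram₀, Matrix.transpose_mul, Matrix.transpose_transpose, hY₀, Matrix.mul_assoc]

/-- [folklore] … hence, in the road's letters, `deflJet₀ (K+B) W = K + defect K B W` (symmetric `K`, `B`). -/
theorem deflJet₀_add_eq (K B : Matrix ι ι ℝ) (hK : Kᵀ = K) (hB : Bᵀ = B) :
    deflJet₀ (K + B) W₀ = K + defect K B W₀ := by
  have hY : (K + B)ᵀ = K + B := by rw [Matrix.transpose_add, hK, hB]
  rw [deflJet₀_eq_deflate (K + B) W₀ hY, defect_def]
  abel

omit [Fintype κ] [DecidableEq κ] in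
/-- [folklore] A first Gram jet of symmetric weights is symmetric. -/
theorem gram₁_transpose_of_symm {B₀ B₁ : Matrix ι ι ℝ} (W₀ W₁ : Matrix ι κ ℝ) (h₀ : B₀ᵀ = B₀) (h₁ : B₁ᵀ = B₁) :
    (gram₁ W₀ W₁ B₀ B₁)ᵀ = gram₁ W₀ W₁ B₀ B₁ := by
  simp only [gram₁, Matrix.transpose_add, Matrix.transpose_mul, Matrix.transpose_transpose, h₀, h₁, Matrix.add_mul, Matrix.mul_assoc]
  abel

omit [Fintype κ] [DecidableEq κ] in
/-- [folklore] A mixed Gram jet of symmetric weights is symmetric. -/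
theorem gramMix_transpose_of_symm {B₀ Bₛ Bₜ Bₛₜ : Matrix ι ι ℝ} (W₀ Wₛ Wₜ Wₛₜ : Matrix ι κ ℝ) (h₀ : B₀ᵀ = B₀) (hₛ : Bₛᵀ = Bₛ)
    (hₜ : Bₜᵀ = Bₜ) (hₛₜ : Bₛₜᵀ = Bₛₜ) :
    (gramMix W₀ Wₛ Wₜ Wₛₜ B₀ Bₛ Bₜ Bₛₜ)ᵀ = gramMix W₀ Wₛ Wₜ Wₛₜ B₀ Bₛ Bₜ Bₛₜ := by
  simp only [gramMix, Matrix.transpose_add, Matrix.transpose_mul, Matrix.transpose_transpose, h₀, hₛ, hₜ, hₛₜ, Matrix.mul_assoc]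
  abel

omit [Fintype ι] in
/-- [folklore] The first inverse jet of symmetric data is symmetric. -/
theorem invJet₁_transpose_of_symm {G₀ G₁ : Matrix κ κ ℝ} (h₀ : G₀ᵀ = G₀) (h₁ : G₁ᵀ = G₁) : (invJet₁ G₀ G₁)ᵀ = invJet₁ G₀ G₁ := by
  have hi : (G₀⁻¹)ᵀ = G₀⁻¹ := by rw [transpose_nonsing_inv, h₀]
  simp only [invJet₁, Matrix.transpose_neg, Matrix.transpose_mul, hi, h₁, Matrix.mul_assoc]

omit [Fintype ι] in
/-- [folklore] The mixed inverse jet of symmetric data is symmetric (the two cross terms swap). -/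
theorem invJetMix_transpose_of_symm {G₀ Gₛ Gₜ Gₛₜ : Matrix κ κ ℝ} (h₀ : G₀ᵀ = G₀) (hₛ : Gₛᵀ = Gₛ) (hₜ : Gₜᵀ = Gₜ) (hₛₜ : Gₛₜᵀ = Gₛₜ) :
    (invJetMix G₀ Gₛ Gₜ Gₛₜ)ᵀ = invJetMix G₀ Gₛ Gₜ Gₛₜ := by
  have hi : (G₀⁻¹)ᵀ = G₀⁻¹ := by rw [transpose_nonsing_inv, h₀]
  simp only [invJetMix, Matrix.transpose_sub, Matrix.transpose_add, Matrix.transpose_mul, hi, hₛ, hₜ, hₛₜ, Matrix.mul_assoc]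
  abel

omit [Fintype κ] [DecidableEq κ] in
/-- [folklore] The FP Gram `Φ₀ = W₀ᵀY₀W₀` of a symmetric form is symmetric. -/
theorem gram₀_transpose_of_symm (hY₀ : Y₀ᵀ = Y₀) : (gram₀ W₀ Y₀)ᵀ = gram₀ W₀ Y₀ := by
  simp only [gram₀, Matrix.transpose_mul, Matrix.transpose_transpose, hY₀, Matrix.mul_assoc]

/-- [folklore] The deflated form of a symmetric form is symmetric. -/
theorem deflJet₀_transpose (hY₀ : Y₀ᵀ = Y₀) : (deflJet₀ Y₀ W₀)ᵀ = deflJet₀ Y₀ W₀ := by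
  have hΦt : (gram₀ W₀ Y₀)ᵀ = gram₀ W₀ Y₀ := gram₀_transpose_of_symm Y₀ W₀ hY₀
  unfold deflJet₀
  set P : Matrix κ κ ℝ := (gram₀ W₀ Y₀)⁻¹ with hP
  have hi : Pᵀ = P := by rw [hP, transpose_nonsing_inv, hΦt]
  simp only [gram₀, Matrix.transpose_sub, Matrix.transpose_mul, Matrix.transpose_transpose, hY₀, hi, Matrix.mul_assoc]

/-- [folklore] The first deflated jet of symmetric data is symmetric. -/
theorem deflJet₁_transpose (hY₀ : Y₀ᵀ = Y₀) (hYₛ : Yₛᵀ = Yₛ) : (deflJet₁ Y₀ Yₛ W₀ Wₛ)ᵀ = deflJet₁ Y₀ Yₛ W₀ Wₛ := by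
  have hΦt : (gram₀ W₀ Y₀)ᵀ = gram₀ W₀ Y₀ := gram₀_transpose_of_symm Y₀ W₀ hY₀
  have hi : ((gram₀ W₀ Y₀)⁻¹)ᵀ = (gram₀ W₀ Y₀)⁻¹ := by rw [transpose_nonsing_inv, hΦt]
  have hΦₛ : (gram₁ W₀ Wₛ Y₀ Yₛ)ᵀ = gram₁ W₀ Wₛ Y₀ Yₛ := gram₁_transpose_of_symm W₀ Wₛ hY₀ hYₛ
  have hAₛ : (invJet₁ (gram₀ W₀ Y₀) (gram₁ W₀ Wₛ Y₀ Yₛ))ᵀ = invJet₁ (gram₀ W₀ Y₀) (gram₁ W₀ Wₛ Y₀ Yₛ) :=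
    invJet₁_transpose_of_symm hΦt hΦₛ
  unfold deflJet₁
  rw [Matrix.transpose_sub, hYₛ, gram₁_transpose_of_symm _ _ hi hAₛ]

/-- [folklore] The mixed deflated jet of symmetric data is symmetric. -/
theorem deflJetMix_transpose (hY₀ : Y₀ᵀ = Y₀) (hYₛ : Yₛᵀ = Yₛ) (hYₜ : Yₜᵀ = Yₜ) (hYₛₜ : Yₛₜᵀ = Yₛₜ) :
    (deflJetMix Y₀ Yₛ Yₜ Yₛₜ W₀ Wₛ Wₜ Wₛₜ)ᵀ = deflJetMix Y₀ Yₛ Yₜ Yₛₜ W₀ Wₛ Wₜ Wₛₜ := by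
  have hΦt : (gram₀ W₀ Y₀)ᵀ = gram₀ W₀ Y₀ := gram₀_transpose_of_symm Y₀ W₀ hY₀
  have hi : ((gram₀ W₀ Y₀)⁻¹)ᵀ = (gram₀ W₀ Y₀)⁻¹ := by rw [transpose_nonsing_inv, hΦt]
  have hΦₛ : (gram₁ W₀ Wₛ Y₀ Yₛ)ᵀ = gram₁ W₀ Wₛ Y₀ Yₛ := gram₁_transpose_of_symm W₀ Wₛ hY₀ hYₛ
  have hΦₜ : (gram₁ W₀ Wₜ Y₀ Yₜ)ᵀ = gram₁ W₀ Wₜ Y₀ Yₜ := gram₁_transpose_of_symm W₀ Wₜ hY₀ hYₜ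
  have hΦₛₜ : (gramMix W₀ Wₛ Wₜ Wₛₜ Y₀ Yₛ Yₜ Yₛₜ)ᵀ = gramMix W₀ Wₛ Wₜ Wₛₜ Y₀ Yₛ Yₜ Yₛₜ :=
    gramMix_transpose_of_symm W₀ Wₛ Wₜ Wₛₜ hY₀ hYₛ hYₜ hYₛₜ
  unfold deflJetMix
  rw [Matrix.transpose_sub, hYₛₜ, gramMix_transpose_of_symm _ _ _ _ hi (invJet₁_transpose_of_symm hΦt hΦₛ)
    (invJet₁_transpose_of_symm hΦt hΦₜ) (invJetMix_transpose_of_symm hΦt hΦₛ hΦₜ hΦₛₜ)]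

end Algebra

/-! ## §3 The Ward letters of the deflated jets are identities -/

section Letters

variable (Y₀ Yₛ Yₜ Yₛₜ : Matrix ι ι ℝ) (W₀ Wₛ Wₜ Wₛₜ : Matrix ι κ ℝ)

/-- [folklore] ORDER 0: the deflated form kills the gauge modes (PART 1's `deflate_mul_basis` in this file's currency). -/
theorem deflJet₀_mul_basis (hY₀ : Y₀ᵀ = Y₀) (hΦ : IsUnit (gram₀ W₀ Y₀).det) : deflJet₀ Y₀ W₀ * W₀ = 0 := by
  rw [deflJet₀_eq_deflate Y₀ W₀ hY₀]
  exact deflate_mul_basis Y₀ W₀ hΦ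

/-- [folklore] **ORDER 1: `K̃ₛ·W₀ + K̃₀·Wₛ = 0`** — the first jet of `(deflated)(u)·W(u) ≡ 0`, as an identity of the formal jets (symmetric `Y•`,
`det Φ₀ ≠ 0`; NO Ward letter on `Y`). -/
theorem deflJet₁_mul_basis (hY₀ : Y₀ᵀ = Y₀) (hYₛ : Yₛᵀ = Yₛ) (hΦ : IsUnit (gram₀ W₀ Y₀).det) :
    deflJet₁ Y₀ Yₛ W₀ Wₛ * W₀ + deflJet₀ Y₀ W₀ * Wₛ = 0 := by
  simp only [deflJet₁, deflJet₀, coT₁, invJet₁]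
  set P : Matrix κ κ ℝ := (gram₀ W₀ Y₀)⁻¹ with hP
  -- the contraction `Φ₀⁻¹·(W₀ᵀY₀W₀) = 1` in right-associated form (all contractions in the expansion are of this terminal shape)
  have r1 : P * (W₀ᵀ * (Y₀ * W₀)) = 1 := by
    have h := nonsing_inv_mul _ hΦ
    rw [← hP] at h
    simpa only [gram₀, Matrix.mul_assoc] using h
  simp only [gram₀, gram₁, Matrix.transpose_add, Matrix.transpose_mul, Matrix.transpose_transpose, hY₀, hYₛ, Matrix.mul_add,
    Matrix.add_mul, Matrix.neg_mul, Matrix.mul_neg, Matrix.sub_mul, Matrix.mul_assoc, r1, Matrix.mul_one]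
  abel

/-- [folklore] **ORDER 2, MIXED: `K̃ₛₜ·W₀ + K̃ₛ·Wₜ + K̃ₜ·Wₛ + K̃₀·Wₛₜ = 0`** — the mixed second jet of `(deflated)·W ≡ 0`, as an identity of
the formal jets (symmetric `Y•`, `det Φ₀ ≠ 0`; NO Ward letter on `Y`).  (86 raw monomials cancel after contracting `Φ₀⁻¹·W₀ᵀY₀W₀ = 1`.) -/
theorem deflJetMix_mul_basis (hY₀ : Y₀ᵀ = Y₀) (hYₛ : Yₛᵀ = Yₛ) (hYₜ : Yₜᵀ = Yₜ) (hYₛₜ : Yₛₜᵀ = Yₛₜ) (hΦ : IsUnit (gram₀ W₀ Y₀).det) :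
    deflJetMix Y₀ Yₛ Yₜ Yₛₜ W₀ Wₛ Wₜ Wₛₜ * W₀ + deflJet₁ Y₀ Yₛ W₀ Wₛ * Wₜ + deflJet₁ Y₀ Yₜ W₀ Wₜ * Wₛ
        + deflJet₀ Y₀ W₀ * Wₛₜ = 0 := by
  simp only [deflJetMix, deflJet₁, deflJet₀, coT₁, coTMix, invJet₁, invJetMix]
  set P : Matrix κ κ ℝ := (gram₀ W₀ Y₀)⁻¹ with hP
  -- the contraction `Φ₀⁻¹·(W₀ᵀY₀W₀) = 1` in right-associated form (all contractions in the expansion are of this terminal shape)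
  have r1 : P * (W₀ᵀ * (Y₀ * W₀)) = 1 := by
    have h := nonsing_inv_mul _ hΦ
    rw [← hP] at h
    simpa only [gram₀, Matrix.mul_assoc] using h
  simp only [gram₀, gram₁, gramMix, Matrix.transpose_add, Matrix.transpose_mul, Matrix.transpose_transpose, hY₀, hYₛ, hYₜ, hYₛₜ,
    Matrix.mul_add, Matrix.add_mul, Matrix.neg_mul, Matrix.mul_neg, Matrix.sub_mul, Matrix.mul_sub, Matrix.mul_assoc, r1, Matrix.mul_one]
  abel

/-- [folklore] ORDER 2, PURE (the diagonal `t := s` of the mixed letter, in K-TA4G's `2•` shape):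
`K̃ₛₛ·W₀ + 2•(K̃ₛ·Wₛ) + K̃₀·Wₛₛ = 0` with `K̃ₛₛ := deflJetMix Y₀ Yₛ Yₛ Yₛₛ W₀ Wₛ Wₛ Wₛₛ`. -/
theorem deflJetMix_mul_basis_diag (Yₛₛ : Matrix ι ι ℝ) (Wₛₛ : Matrix ι κ ℝ) (hY₀ : Y₀ᵀ = Y₀) (hYₛ : Yₛᵀ = Yₛ) (hYₛₛ : Yₛₛᵀ = Yₛₛ)
    (hΦ : IsUnit (gram₀ W₀ Y₀).det) :
    deflJetMix Y₀ Yₛ Yₛ Yₛₛ W₀ Wₛ Wₛ Wₛₛ * W₀ + (2 : ℝ) • (deflJet₁ Y₀ Yₛ W₀ Wₛ * Wₛ) + deflJet₀ Y₀ W₀ * Wₛₛ = 0 := by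
  rw [two_smul, ← add_assoc]
  exact deflJetMix_mul_basis Y₀ Yₛ Yₛ Yₛₛ W₀ Wₛ Wₛ Wₛₛ hY₀ hYₛ hYₛ hYₛₛ hΦ

/-- [folklore] ORDER 0, transposed: `K̃₀ᵀ·W₀ = 0`. -/
theorem deflJet₀_transpose_mul_basis (hY₀ : Y₀ᵀ = Y₀) (hΦ : IsUnit (gram₀ W₀ Y₀).det) : (deflJet₀ Y₀ W₀)ᵀ * W₀ = 0 := by
  rw [deflJet₀_transpose Y₀ W₀ hY₀]; exact deflJet₀_mul_basis Y₀ W₀ hY₀ hΦ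

/-- [folklore] ORDER 1, transposed: `K̃ₛᵀ·W₀ + K̃₀ᵀ·Wₛ = 0`. -/
theorem deflJet₁_transpose_mul_basis (hY₀ : Y₀ᵀ = Y₀) (hYₛ : Yₛᵀ = Yₛ) (hΦ : IsUnit (gram₀ W₀ Y₀).det) :
    (deflJet₁ Y₀ Yₛ W₀ Wₛ)ᵀ * W₀ + (deflJet₀ Y₀ W₀)ᵀ * Wₛ = 0 := by
  rw [deflJet₁_transpose Y₀ Yₛ W₀ Wₛ hY₀ hYₛ, deflJet₀_transpose Y₀ W₀ hY₀]
  exact deflJet₁_mul_basis Y₀ Yₛ W₀ Wₛ hY₀ hYₛ hΦ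

/-- [folklore] ORDER 2 MIXED, transposed: `K̃ₛₜᵀ·W₀ + K̃ₛᵀ·Wₜ + K̃ₜᵀ·Wₛ + K̃₀ᵀ·Wₛₜ = 0`. -/
theorem deflJetMix_transpose_mul_basis (hY₀ : Y₀ᵀ = Y₀) (hYₛ : Yₛᵀ = Yₛ) (hYₜ : Yₜᵀ = Yₜ) (hYₛₜ : Yₛₜᵀ = Yₛₜ)
    (hΦ : IsUnit (gram₀ W₀ Y₀).det) :
    (deflJetMix Y₀ Yₛ Yₜ Yₛₜ W₀ Wₛ Wₜ Wₛₜ)ᵀ * W₀ + (deflJet₁ Y₀ Yₛ W₀ Wₛ)ᵀ * Wₜ + (deflJet₁ Y₀ Yₜ W₀ Wₜ)ᵀ * Wₛ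
        + (deflJet₀ Y₀ W₀)ᵀ * Wₛₜ = 0 := by
  rw [deflJetMix_transpose Y₀ Yₛ Yₜ Yₛₜ W₀ Wₛ Wₜ Wₛₜ hY₀ hYₛ hYₜ hYₛₜ, deflJet₁_transpose Y₀ Yₛ W₀ Wₛ hY₀ hYₛ,
    deflJet₁_transpose Y₀ Yₜ W₀ Wₜ hY₀ hYₜ, deflJet₀_transpose Y₀ W₀ hY₀]
  exact deflJetMix_mul_basis Y₀ Yₛ Yₜ Yₛₜ W₀ Wₛ Wₜ Wₛₜ hY₀ hYₛ hYₜ hYₛₜ hΦ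

/-- [folklore] ORDER 2 PURE, transposed: `K̃ₛₛᵀ·W₀ + 2•(K̃ₛᵀ·Wₛ) + K̃₀ᵀ·Wₛₛ = 0`. -/
theorem deflJetMix_transpose_mul_basis_diag (Yₛₛ : Matrix ι ι ℝ) (Wₛₛ : Matrix ι κ ℝ) (hY₀ : Y₀ᵀ = Y₀) (hYₛ : Yₛᵀ = Yₛ)
    (hYₛₛ : Yₛₛᵀ = Yₛₛ) (hΦ : IsUnit (gram₀ W₀ Y₀).det) :
    (deflJetMix Y₀ Yₛ Yₛ Yₛₛ W₀ Wₛ Wₛ Wₛₛ)ᵀ * W₀ + (2 : ℝ) • ((deflJet₁ Y₀ Yₛ W₀ Wₛ)ᵀ * Wₛ) + (deflJet₀ Y₀ W₀)ᵀ * Wₛₛ = 0 := by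
  rw [deflJetMix_transpose Y₀ Yₛ Yₛ Yₛₛ W₀ Wₛ Wₛ Wₛₛ hY₀ hYₛ hYₛ hYₛₛ, deflJet₁_transpose Y₀ Yₛ W₀ Wₛ hY₀ hYₛ,
    deflJet₀_transpose Y₀ W₀ hY₀]
  exact deflJetMix_mul_basis_diag Y₀ Yₛ W₀ Wₛ Yₛₛ Wₛₛ hY₀ hYₛ hYₛₛ hΦ

end Letters

end Summit.QuantumFields.BalabanUV.Beta.D1BFx.SliceTransferDefectJets

end
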